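import Mathlib
import HarnessLib
import HarnessLib.Audit
import Summits.Langlands.Statement
import Literature.NumberTheory.GaloisRepresentations.ResidualGaloisRep
import Literature.NumberTheory.GaloisRepresentations.ProjectiveType
import Literature.NumberTheory.GaloisRepresentations.LabelledHodgeTateWeights
import HarnessLib.Audit.Status.Attr

/-!
Route: OddResidueBelowFive

DORMANT since 2026-08-24T00:21:53Z (reconciler: no traction for 6.4 d (last activity item-evidence-added at 2026-08-17T14:52:08Z); parked, not closed — `ledger route dormant route-Langlands-OddResidueBelowFive --off` to reactivate) — unstaffed, not closed; items shared with open routes are served there. `ledger route dormant <id> --off` reactivates.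

# Route OddResidueBelowFive — odd Fontaine–Mazur over Q below its printed bound p ≥ 5 — the
exceptional 3-adic block and the two small 2-adic images

NEAR-MISS HARVEST (lens 3.15; artefact DEFICIT.md in the planner folder). The odd, regular
Fontaine–Mazur theorem for GL₂/ℚ — clause (B)
of the summit on the sector {F = ℚ, n = 2, det ρ(c) = −1, distinct Hodge–Tate weights} — is printed
"for p ≥ 5" (Pan, JAMS 35 (2022)
Thm 1.0.4; Calegari ICM 2022 §7.2). It suffices to show X = OddRegularModular: the same statement at
EVERY prime (weak automorphy:
an L-algebraic cuspidal π of GL₂(𝔸_ℚ) with Satake–Frobenius matching at almost all places), typed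
over the Statement's own cone
(IsOdd, pinned Fontaine datum, `labelledHodgeTateWeightsAt … .Nodup`, `SatakeFrobCompatibleAt`).
Re-deriving the union of printed
cells with today's inputs (DEFICIT.md §2) leaves exactly three residual cells, which are the cruxes:
C1 TwoAdicEisenstein (p = 2, ρ̄
reducible), C2 TwoAdicDihedral (p = 2, ρ̄ absolutely irreducible with solvable = dihedral image), C3
ThreeAdicSmallImage (p = 3, ρ̄
reducible or dihedral, ρ|G_ℚ₃ irreducible: the exceptional Bernstein block (η, ηω), ω = ω⁻¹).
Everything else is the supports
KnownOddPrimeCells / KnownTwoAdicBigImage (in print) and the rest of the summit is the support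
OddSectorToLanglands (X → Langlands), not attacked here.
Lean: `∀ (p : ℕ) [Fact p.Prime], ∀ (ρ :
Literature.NumberTheory.GaloisRepresentations.FramedGaloisRep ℚ (PadicAlgCl p) 2), ρ.IsOdd →
ρ.toGaloisRep.IsIrreducible → (∀ᶠ v : IsDedekindDomain.HeightOneSpectrum (NumberField.RingOfIntegers
ℚ) in Filter.cofinite, ρ.IsUnramifiedAt v) → (∀ (v : IsDedekindDomain.HeightOneSpectrum
(NumberField.RingOfIntegers ℚ)) (hv : ((p : ℕ) : NumberField.RingOfIntegers ℚ) ∈ v.asIdeal),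
(Literature.NumberTheory.PAdicHodge.fontainePstAdicCompletion v p hv).IsDeRhamFramed (ρ.toLocal v) ∧
∀ τ : v.adicCompletion ℚ →+* PadicAlgCl p, Continuous τ → (ρ.labelledHodgeTateWeightsAt v
(Literature.NumberTheory.PAdicHodge.fontainePstAdicCompletion v p hv).algebra
(Literature.NumberTheory.PAdicHodge.fontainePstAdicCompletion v p hv).𝔅 τ).Nodup) → ∀ (ι :
PadicAlgCl p ≃+* ℂ) (hcpt : Literature.NumberTheory.Automorphic.isCompact_glFiniteIntegralLevel 2
ℚ), ∃ π : Literature.NumberTheory.Automorphic.CuspidalAutomorphicRepData 2 ℚ hcpt, π.1.IsLAlgebraic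
∧ ∀ᶠ v : IsDedekindDomain.HeightOneSpectrum (NumberField.RingOfIntegers ℚ) in Filter.cofinite,
Summit.Langlands.SatakeFrobCompatibleAt ι π.1 ρ v`

## Assembly
Pure logic, certified by the deciding theorem in glue.lean (rc 0 in Sketch.lean; native check):
`closes : TwoAdicEisenstein →
TwoAdicDihedral → ThreeAdicSmallImage → KnownOddPrimeCells → KnownTwoAdicBigImage →
OddSectorToLanglands → Langlands` := OddSectorToLanglands applied to the
target, assembled inline from the three cruxes and the four known cells by a case split on p (p = 2;
p = 3; else 5 ≤ p since a prime ≠ 2, 3 is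
≠ 4) and, at p = 2, on residual absolute irreducibility / dihedral type, at p = 3 on (reducible ∨
dihedral) and on irreducibility of
ρ|G_ℚ₃ (classical `by_cases`).

Rationale: WHY THIS LINE. The printed chain is a union of cells, each closed by a named engine with a printed
hypothesis (DEFICIT.md §1: Kisin 2009, Hu–Tan,
Skinner–Wiles 1999/2001, Pan arXiv:1901.07166, Tung arXiv:1803.07451 and arXiv:1908.06174, Allen
arXiv:1301.1113, Khare–Wintenberger);
re-running it shows p ≥ 5 enters ONLY through Paškūnas's Bernstein-centre theorems "in cases
(1)–(4)" (Pan Thms 3.4.5/3.4.6 and the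
[Pas13] appendices used in the dimension count) and through "p odd" in the Skinner–Wiles treatment
of complex conjugation. The first
input MOVED: Paškūnas–Tung arXiv:2104.08948 (2021) prove the centre/finiteness results for ALL
blocks (Z_𝔅 = (R^ps)_tf for p ≠ 2,
R^ps[1/p] ≅ Z_𝔅[1/p]) but only cash it for EQUAL weights; the classicality half is now free at every
prime (Pan, Ann. Math. 2026 =
arXiv:2209.06366 Thm 1.1.2), so each residual cell is an OCCURRENCE-in-completed-cohomology
statement. Imported: p-adic
representation theory of GL₂(ℚ_p) at the exceptional primes (blocks, Cayley–Hamilton quotients),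
commutative algebra of Böckle's
singular 3-adic deformation ring (Astérisque 330), 2-adic Hida/patching technology (Allen's
unipotent-element substitute for the
(+1,−1)-eigenlines of c). No listed route touches the odd residue over ℚ: EisensteinGelfandKirillov
(opened today) is p ≥ 5 with F_v ≠ ℚ_p,
FifteenLocusEisenstein / SkinnerWilesDefectOne are imaginary quadratic, EvenVoidBelowEight /
EvenSkinnerWilesMirror / MirrorPairReflection are
EVEN; the card one-relator-worlds (graded variant) is the conductor-2^∞ corner of C1 only.

RANKED CRUXES. #0 OddRegularModular (target) — for every prime p and every ρ : Γ_ℚ → GL₂(ℚ̄_p)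
continuous, odd, irreducible, unramified at all but finitely many places, de Rham at the place above
p (pinned Fontaine datum) with multiplicity-free labelled Hodge–Tate weights, and every ι : ℚ̄_p ≃
ℂ, there is an L-algebraic cuspidal π of GL₂(𝔸_ℚ) whose Satake parameters match the Frobenius
characteristic polynomials of ρ at all but finitely many places (Pan 2022 Thm 1.0.4 with "p ≥ 5" ↦
"every p"). (why it might fail: only through C1–C3 below: a non-pro-modular odd regular 2-adic ρ
with Eisenstein reduction would refute it (none is expected; Chenevier's 2-adic level-1 fern is
Zariski-dense).) [arXiv:1901.07166, arXiv:2109.14145, FontaineMazurGeometric1995, BuzzardGeeLMS2014]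
#2 TwoAdicEisenstein (crux) — the target at p = 2 for ρ whose reduction is absolutely REDUCIBLE
(ρ̄^ss = χ̄₁ ⊕ χ̄₂; by Tate every ρ of conductor 2^k is here): the cell where every printed
residually-reducible engine (Skinner–Wiles 1999, Pan 2022, Thorne, Allen–Newton–Thorne, X. Zhang
2024/25) assumes p odd — the binding input of the near-miss at its ceiling, typed with the number 2.
[difficulty: open-problem] (why it might fail: at p = 2 complex conjugation may act unipotently mod
2, so the Skinner–Wiles codimension count of the reducible locus and Pan's dim 𝕋 ≥ 3 / nice-prime
existence have no printed substitute; Z_𝔅 ⊋ (R^ps)_tf is possible (PT Thm 1.4: cokernel killed by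
2).) [doi:10.1007/bf02698855, arXiv:1901.07166, arXiv:2104.08948, arXiv:1301.1113, arXiv:0809.0415,
arXiv:2411.18661]
#3 TwoAdicDihedral (crux) — the target at p = 2 for ρ whose reduction is absolutely irreducible of
DIHEDRAL type (= solvable image in characteristic 2; Allen 2014 covers the nearly ordinary case
except ρ̄ induced from an imaginary quadratic field in which 2 splits): the non-ordinary dihedral
cell and the CM-split ordinary corner. [difficulty: XL] (why it might fail: no 2-adic Taylor–Wiles
primes for dihedral image off Hida families (image too small; Allen needs a non-trivial unipotent
via Pink), and Hida's nearly ordinary Hecke algebra has CM components in the 2-split imaginary case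
— a Pan-type completed-homology patching at 2 is unwritten.) [arXiv:1301.1113, arXiv:1908.06174,
doi:10.1007/s00222-009-0207-5, arXiv:2104.08948, arXiv:1901.07166]
#4 ThreeAdicSmallImage (crux) — the target at p = 3 for ρ with ρ̄ absolutely reducible OR of
dihedral type and ρ|G_ℚ₃ (absolutely) irreducible: re-run Pan 2022 (Thm 1.0.2 and §9) in the
exceptional block 𝔅 = {1, Sp, ω∘det, Sp⊗ω}⊗δ (Pan's excluded case (5): (ρ̄|G_ℚ₃)^ss = η ⊕ ηω) with
Paškūnas–Tung 2021 Thms 1.3/1.4/Cor 1.5 in place of [Pas13] Thms 1.2/1.5, Böckle's explicit ring in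
place of Cor 9.13/B.20, and Pan II Thm 1.1.2 for classicality; the off-block and ordinary sub-cells
are in print (DEFICIT.md §2). [difficulty: L] (why it might fail: Böckle's ring R(1 ⊕ ω, p = 3) is
not formally smooth, so Pan's two dimension inequalities (a component of dim ≥ 1 + 2 through 𝔭 whose
ordinary locus is cut by ONE equation) and the existence of nice primes may fail in the exceptional
block; E_𝔅 is only finite over Z_𝔅, not computed.) [arXiv:1901.07166, arXiv:2104.08948,
zbl:1223.11141, arXiv:2209.06366, doi:10.5802/afst.988, arXiv:2105.05823]
#9 KnownOddPrimeCells (support) — the printed cells at ODD primes, as named facts to vendor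
(first-prover duty): (i) p ≥ 5, all ρ̄ (Pan 2022 Thm 1.0.4 = Kisin + Hu–Tan + Paškūnas +
Skinner–Wiles + Pan); (ii) p = 3, ρ̄ absolutely irreducible and not dihedral (then ρ̄|G_ℚ(ζ₃) is
absolutely irreducible: Tung ANT 2021 Thm 1, residual modularity by Khare–Wintenberger); (iii) p =
3, ρ̄ reducible or dihedral with ρ|G_ℚ₃ reducible (nearly ordinary: Skinner–Wiles 1999/2001, Pan
2022 §6 and Thm 1.0.4 — the exceptional-block proviso does not touch these). [difficulty:
provable-now] [arXiv:1901.07166, arXiv:1803.07451, doi:10.1007/bf02698855, doi:10.5802/afst.988,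
doi:10.1007/s00222-009-0205-7]
#9 KnownTwoAdicBigImage (support) — the printed cell at p = 2: ρ̄ absolutely irreducible and not
dihedral (= non-solvable image, by Dickson's classification in characteristic 2: A₄ lands in a
Borel, S₄ does not embed) ⇒ modular (Tung Math. Z. 2021 Thm 1; residual modularity by
Khare–Wintenberger). [difficulty: provable-now] [arXiv:1908.06174, doi:10.1007/s00222-009-0205-7,
arXiv:1301.1113]
#9 OddSectorToLanglands (support) — the honest rest of the summit along this line — Langlands given
the odd regular Fontaine–Mazur theorem over ℚ at every prime (local–global compatibility at ALL
places for classical forms via Carayol/Saito and strong multiplicity one; clause (A); even ρ; equal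
weights; n ≠ 2; other fields); NOT attacked by this route, shared in kind with every sector route of
the summit. [difficulty: open-problem] [BuzzardGeeLMS2014, FontaineMazurGeometric1995]

TWO-LAYER PLAN. Foreseen glued splits (k ≤ 3, depth 1), filed only when a crux closes or stalls; all
typed and kernel-checked in bc/*_birth.lean:
C1 ⇐ (ρ|G_ℚ₂ reducible: 2-adic Skinner–Wiles) → (ρ|G_ℚ₂ irreducible: 2-adic Pan) → C1; C2 ⇐ (nearly
ordinary incl. the CM-split corner)
→ (non-ordinary) → C2; C3 ⇐ (ρ̄ reducible: Pan Thm 1.0.2 in block (5)) → (ρ̄ dihedral: Pan §9 in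
block (5)) → C3. Inside C3 the
mechanism-level children a tenure planner would file: Böckle-ring dimension lemmas →
exceptional-block local–global compatibility of the
two R^ps-actions (Pan Thm 3.5.x with PT's υ) → occurrence in H̃¹ → Pan II classicality (support).

KILL CRITERIA. (K1) A refuter exhibits an odd, regular, a.e. unramified ρ in one of the three cells
together with a PROOF of non-automorphy (e.g. an
explicit 2-adic ρ of conductor 2^k whose traces provably match no eigenform): that refutes the crux,
the target and clause (B) of the summit
at once — close `refuted:<Decl>` and file ¬Langlands evidence. (K2) The Böckle-ring computation
(Cheapest falsifier) shows Pan's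
dimension inequality fails in block (5): C3 is re-ranked to 2 as a new-method crux (not refuted).
(K3) A printed sequel (Pan / Paškūnas–Tung /
X. Zhang) closes a cell: that crux becomes `known` — superseded for staffing, the route still
decides its sector. (K4) If C1 is shown to
need the automorphy of EVEN or irregular objects (it should not: all ρ here are odd regular), the
typing is wrong — restate.

NOT DECOMPOSED YET. Equal Hodge–Tate weights (odd irregular = weight one: Pan Forum Pi 2022 Thm
1.0.5 + Paškūnas–Tung; its p = 2 / ρ̄|ℚ(ζ_p)-reducible
residue is a different route); EVEN ρ (routes EvenVoidBelowEight, EvenSkinnerWilesMirror,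
MirrorPairReflection); totally real F ≠ ℚ with p
split (Tung/Pan print "F totally real, p splits completely" versions — an ascent a tenure planner
may add as support); the interior of C3
(block-(5) local–global compatibility, nice primes, Böckle-ring lemmas) and of C1 (a 2-adic
substitute for the c-eigenline arguments);
the vendoring of the four known cells as Literature named facts (first-prover duty, D-0027 §3.3).

CHEAPEST FALSIFIER. One kit job (not run here: Böckle's equations must first be transcribed from
Astérisque 330, zbl:1223.11141): from Böckle's explicit
presentation of the versal deformation ring of ρ̄ = (1 ∗; 0 ω) over ℤ₃ and the pseudo-deformation
ring of tr(1 ⊕ ω) (PT 2021 appendix),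
compute with Macaulay2/Singular (a) the Krull dimension of R^ps (Pan needs 1 + 3), (b) the height of
the ideal of the reducible locus and
whether ker(R^ps → R^ps,red) is principal (Pan's lemma Corddim via [Pas13] Cor B.20), (c) 𝒪-flatness
(PT Thm 1.4: Z_𝔅 = (R^ps)_tf).
Either outcome is informative (K2). Literature kill already run (2026-08-17): `lit citing
doi:10.1090/jams/991` (46 works) and
`lit citing doi:10.1017/fms.2021.72` (13 works): no paper treats the regular-weight p = 3
exceptional block or the p = 2 small-image cells;
zbMATH "Fontaine-Mazur conjecture residually reducible" (5: Skinner–Wiles, Pan, X. Zhang ×2, Berger)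
confirms the p-odd standing hypothesis.

NUMBERS. Printed thresholds: p ≥ 5 (Pan 2022 Abstract/Thm 1.0.4; Calegari ICM §7.2); p = 3 proviso
"(χ̄₁/χ̄₂)|G_ℚ₃ ≠ ω" (Pan Thm 1.0.2) /
"(ρ̄|G_ℚ₃)^ss ≠ η ⊕ ηω" (Thm 1.0.4); Paškūnas's block theorems "p ≥ 5" (Publ. IHÉS 118) and "cases
(1)–(4)" (Pan §3.4.4), ALL blocks since
2021 (PT Thm 1.3/1.4, cokernel killed by 2 at p = 2); Tung: p > 2 & ρ̄|ℚ(ζ_p) abs. irreducible (ANT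
Thm 1), p = 2 & non-solvable image
(Math. Z. Thm 1); Allen: p = 2, dihedral, nearly ordinary, condition (5); Skinner–Wiles: p odd,
χ|D_p ≠ 1, ordinary, k ≥ 2; Pan II
classicality: any p. This route: v₀ = 5 → v₁ = 3 needs C3 alone (one block, two residual classes);
v₁ = 2 needs C1, C2. Items at open: 8
(target, 3 cruxes, 3 supports, assembly).

DEFINITION REQUESTS. None: FramedGaloisRep.IsOdd, IsUnramifiedAt, toLocal,
toGaloisRep.IsIrreducible, FramedRep.IsIrreducible, labelledHodgeTateWeightsAt,
IsResiduallyAbsIrreducible, residualRep, IsDihedralType, PstWeilDeligneData.IsDeRhamFramed,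
fontainePstAdicCompletion,
CuspidalAutomorphicRepData, IsLAlgebraic, SatakeFrobCompatibleAt all exist (lean search --decl;
Sketch.lean rc 0). Facts a prover will
want as named Literature facts (not filed now, D-0027 §3.3): Pan 2022 Thm 1.0.4 (arXiv:1901.07166),
Tung ANT Thm 1 (arXiv:1803.07451),
Tung Math. Z. Thm 1 (arXiv:1908.06174), Skinner–Wiles 1999 Thm (doi:10.1007/bf02698855) and 2001
(doi:10.5802/afst.988), Khare–Wintenberger
Serre (doi:10.1007/s00222-009-0205-7), Paškūnas–Tung Thms 1.3/1.4 (arXiv:2104.08948), Pan Ann. Math.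
2026 Thm 1.1.2 (arXiv:2209.06366),
Dickson's classification of finite irreducible subgroups of PGL₂(𝔽̄₂) (for KnownTwoAdicBigImage).

Novelty: Searches (2026-08-17; local searchd DOWN (connection reset), OpenAlex/S2/arXiv 429; zbMATH, lit
citing (local graph/API), galaxy live):
zbMATH "Fontaine-Mazur conjecture residually reducible" (5), "2-adic potentially semi-stable
deformation rings modularity" (1),
"modularity 2-adic Galois representations residually reducible" (0), "Kisin modularity of 2-adic
Barsotti-Tate" (3), "Paskunas Tung
finiteness" (→ 2104.08948 READ pp.1–5), "Skinner Wiles nearly ordinary deformations" (2), "Böckle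
deformation rings mod 3" (→ zbl:1223.11141);
lit citing doi:10.1090/jams/991 (46) and doi:10.1017/fms.2021.72 (13); galaxy all "2-adic
Barsotti-Tate representations" (11, none relevant);
reads: arXiv:1901.07166 pp.1–4, 17–18 + grep of all 85 pp.; arXiv:2104.08948 pp.1–5;
arXiv:1908.06174 pp.1–4 + grep; arXiv:1803.07451 Thm 1,
Thm 4.5, Rem 4.6; arXiv:1301.1113 pp.1–4; arXiv:2209.06366 pp.1–3; arXiv:2008.07099 p.5;
arXiv:2109.14145 pp.7, 12–13; arXiv:2607.11763
pp.1–7 (AHTW, consumed for NOTES); the 83 Langlands Theses titles, full read of EvenVoidBelowEight,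
GaloisWeightedBE, EisensteinGelfandKirillov
headers; 29 open + 103 closed card slugs, full read of one-relator-worlds, alphabet-rigidity-e8,
kronecker-rigidity; 9 barrier files (heads);
ledger negatives --problem Langlands (3, unrelated).
Nearest prior art found: Paškūnas–Tung arXiv:2104.08948 (the moved input, cashed only for equal
weights); Pan arXiv:1901.07166 Thm 1.0.4
(prints the p = 3 proviso and p odd); Tung arXiv:1803.07451 p.3 ("  [refs: 10.1090/jams/991, 10.1017/fms.2021.72, 1901.07166, 2104.08948, 1908.06174, 1803.07451, 1301.1113, 2209.06366, 2008.07099, 2109.14145, 2607.11763, 2411.18661, 2512.21249, 2105.05823, 0809.0415, doi:10.1090/jams/991, doi:10.1017/fms.2021.72]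

Barriers (technique_class: pseudodeformation-patching, padic-LL-blocks): - technique_class: pseudodeformation-patching, padic-LL-blocks
- Literature.Barriers.Langlands.ResiduallyReducibleBarrier: APPLIES to C1 and C3 (and its Narrow
form to C2): evaded exactly as Skinner–Wiles/Pan evade it — pseudo-deformation rings instead of
Mazur's functor, Taylor–Wiles patching at one-dimensional (nice) primes where the specialised
representation is irreducible non-dihedral, completed homology made finite over 𝕋 by Paškūnas's
projective envelopes; CONCEDED at p = 2 (C1): the evasion's own entry point (c-eigenlines) fails mod
2 — that is why C1 is rank 2.
- Literature.Barriers.Langlands.PatchingLocalComponentBarrier: evaded as in Pan/Tung: no fixed-type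
local deformation ring at p is imposed (patching with no condition at p, components reached through
the ordinary locus and Colmez–Dospinescu–Paškūnas "every component lies in the image of V̌"); the
Narrow form's invisible components are exactly what PT 2021 Thm 1.4 (R^ps[1/p] ≅ Z_𝔅[1/p]) excludes
for GL₂(ℚ_p).
- Literature.Barriers.Langlands.ModPLanglandsGL2BeyondQpFpBar: not in class — F = ℚ, F_v = ℚ_p
throughout (the one place where the p-adic local Langlands correspondence exists, now for all p and
all blocks).
- Literature.Barriers.Langlands.TaylorWilesNumericalCoincidence: not in class — GL₂/ℚ is the l₀ = 0
case (odd ρ, totally real base).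
- Literature.Barriers.Langlands.SolvableImageBarrier: not engaged — no base change /
Langlands–Tunnell; residual modularity comes from Khare–Wintenberger (any image) and

Novelty grade: variant — route-review (refuter rreview-0817T02-14): VARIANT, and a DUPLICATE to close. (1) Crux C3 ThreeAdicSmallImage (stmt-Langlands-18717, 'p = 3 exceptional block') is KNOWN IN PRINT — X. Zhang arXiv:2412.06812 Thm 1.0.2 (page-checked p0003 L24-37; §5 residually reducible incl. χ̄ = ω⁻¹, §6 Thm 6.1.1): b (refuter refuter-rreview-0817T02-14-0, 2026-08-17T04:08:21Z; prior: arXiv:2412.06812, doi:10.1090/jams/991, doi:10.1017/fms.2021.72, doi:10.1007/s00209-020-02627-5, arXiv:1301.1113)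

History (route lifecycle, newest last):
- 2026-08-24T00:21:53Z · DORMANT — reconciler: no traction for 6.4 d (last activity item-evidence-added at 2026-08-17T14:52:08Z); parked, not closed — `ledger route dormant route-Langlands-OddRes (operator:999:1755802)

sub-problem: Langlands · status: dormant · opened planner-plan-lens3-Langlands-nearmiss-g2-0 2026-08-17T02:57:00Z · rev 1 · ledger route-Langlands-OddResidueBelowFive
GENERATED by the gate from the ledger (D-0016/17). Provers cite these decls: `theorem foo : Summit.Langlands.Langlands.Theses.OddResidueBelowFive.<Decl> := …` in Summits/Langlands/Langlands/Theorems/<Name>.lean.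
-/

namespace Summit.Langlands.Langlands.Theses.OddResidueBelowFive

open scoped BigOperators Topology Manifold Classical MeasureTheory ProbabilityTheory Matrix InnerProductSpace ComplexConjugate ContinuousMap
open Filter Set Function TopologicalSpace MeasureTheory

attribute [summit_statement] _root_.Langlands

/-- item stmt-Langlands-18714 · target · rank 0 · open · by planner
why it might fail: only through C1–C3 below: a non-pro-modular odd regular 2-adic ρ with Eisenstein reduction would refute it (none is expected; Chenevier's 2-adic level-1 fern is Zariski-dense).
sources: arXiv:1901.07166, arXiv:2109.14145, FontaineMazurGeometric1995, BuzzardGeeLMS2014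
[target] for every prime p and every ρ : Γ_ℚ → GL₂(ℚ̄_p) continuous, odd, irreducible, unramified at
all but finitely many places, de Rham at the place above p (pinned Fontaine datum) with
multiplicity-free labelled Hodge–Tate weights, and every ι : ℚ̄_p ≃ ℂ, there is an L-algebraic
cuspidal π of GL₂(𝔸_ℚ) whose Satake parameters match the Frobenius characteristic polynomials of ρ
at all but finitely many places (Pan 2022 Thm 1.0.4 with "p ≥ 5" ↦ "every p"). -/
@[route_item "route-Langlands-OddResidueBelowFive"]
def OddRegularModular : Prop :=
  ∀ (p : ℕ) [Fact p.Prime], ∀ (ρ : Literature.NumberTheory.GaloisRepresentations.FramedGaloisRep ℚ (PadicAlgCl p) 2), ρ.IsOdd → ρ.toGaloisRep.IsIrreducible → (∀ᶠ v : IsDedekindDomain.HeightOneSpectrum (NumberField.RingOfIntegers ℚ) in Filter.cofinite, ρ.IsUnramifiedAt v) → (∀ (v : IsDedekindDomain.HeightOneSpectrum (NumberField.RingOfIntegers ℚ)) (hv : ((p : ℕ) : NumberField.RingOfIntegers ℚ) ∈ v.asIdeal), (Literature.NumberTheory.PAdicHodge.fontainePstAdicCompletion v p hv).IsDeRhamFramed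 (ρ.toLocal v) ∧ ∀ τ : v.adicCompletion ℚ →+* PadicAlgCl p, Continuous τ → (ρ.labelledHodgeTateWeightsAt v (Literature.NumberTheory.PAdicHodge.fontainePstAdicCompletion v p hv).algebra (Literature.NumberTheory.PAdicHodge.fontainePstAdicCompletion v p hv).𝔅 τ).Nodup) → ∀ (ι : PadicAlgCl p ≃+* ℂ) (hcpt : Literature.NumberTheory.Automorphic.isCompact_glFiniteIntegralLevel 2 ℚ), ∃ π : Literature.NumberTheory.Automorphic.CuspidalAutomorphicRepData 2 ℚ hcpt, π.1.IsLAlgebraic ∧ ∀ᶠ v : IsDedekindDomain.HeightOneSpectrum (NumberField.RingOfIntegers ℚ) in Filter.cofinite, Summit.Langlands.SatakeFrobCompatibleAt ι π.1 ρ v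

/-- item stmt-Langlands-18715 · crux · rank 2 · open · by planner
why it might fail: at p = 2 complex conjugation may act unipotently mod 2, so the Skinner–Wiles codimension count of the reducible locus and Pan's dim 𝕋 ≥ 3 / nice-prime existence have no printed substitute; Z_𝔅 ⊋ (R^ps)_tf is possible (PT Thm 1.4: cokernel killed by 2).
sources: doi:10.1007/bf02698855, arXiv:1901.07166, arXiv:2104.08948, arXiv:1301.1113, arXiv:0809.0415, arXiv:2411.18661
[crux] the target at p = 2 for ρ whose reduction is absolutely REDUCIBLE (ρ̄^ss = χ̄₁ ⊕ χ̄₂; by Tate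
every ρ of conductor 2^k is here): the cell where every printed residually-reducible engine
(Skinner–Wiles 1999, Pan 2022, Thorne, Allen–Newton–Thorne, X. Zhang 2024/25) assumes p odd — the
binding input of the near-miss at its ceiling, typed with the number 2. [difficulty: open-problem] -/
@[route_item "route-Langlands-OddResidueBelowFive", crux]
def TwoAdicEisenstein : Prop :=
  ∀ (ρ : Literature.NumberTheory.GaloisRepresentations.FramedGaloisRep ℚ (PadicAlgCl 2) 2), ρ.IsOdd → ρ.toGaloisRep.IsIrreducible → (∀ᶠ v : IsDedekindDomain.HeightOneSpectrum (NumberField.RingOfIntegers ℚ) in Filter.cofinite, ρ.IsUnramifiedAt v) → (∀ (v : IsDedekindDomain.HeightOneSpectrum (NumberField.RingOfIntegers ℚ)) (hv : ((2 : ℕ) : NumberField.RingOfIntegers ℚ) ∈ v.asIdeal), (Literature.NumberTheory.PAdicHodge.fontainePstAdicCompletion v 2 hv).IsDeRhamFramed (ρ.toLocal v) ∧ ∀ τ : v.adicCompletion ℚ →+* PadicAlgCl 2, Continuous τ → (ρ.labelledHodgeTateWeightsAt v (Literature.NumberTheory.PAdicHodge.fontainePstAdicCompletion v 2 hv).algebra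 (Literature.NumberTheory.PAdicHodge.fontainePstAdicCompletion v 2 hv).𝔅 τ).Nodup) → ¬ ρ.IsResiduallyAbsIrreducible → ∀ (ι : PadicAlgCl 2 ≃+* ℂ) (hcpt : Literature.NumberTheory.Automorphic.isCompact_glFiniteIntegralLevel 2 ℚ), ∃ π : Literature.NumberTheory.Automorphic.CuspidalAutomorphicRepData 2 ℚ hcpt, π.1.IsLAlgebraic ∧ ∀ᶠ v : IsDedekindDomain.HeightOneSpectrum (NumberField.RingOfIntegers ℚ) in Filter.cofinite, Summit.Langlands.SatakeFrobCompatibleAt ι π.1 ρ v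

/-- item stmt-Langlands-18716 · crux · rank 3 · open · by planner
why it might fail: no 2-adic Taylor–Wiles primes for dihedral image off Hida families (image too small; Allen needs a non-trivial unipotent via Pink), and Hida's nearly ordinary Hecke algebra has CM components in the 2-split imaginary case — a Pan-type completed-homology patching at 2 is unwritten.
sources: arXiv:1301.1113, arXiv:1908.06174, doi:10.1007/s00222-009-0207-5, arXiv:2104.08948, arXiv:1901.07166
[crux] the target at p = 2 for ρ whose reduction is absolutely irreducible of DIHEDRAL type (=
solvable image in characteristic 2; Allen 2014 covers the nearly ordinary case except ρ̄ induced
from an imaginary quadratic field in which 2 splits): the non-ordinary dihedral cell and the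
CM-split ordinary corner. [difficulty: XL] -/
@[route_item "route-Langlands-OddResidueBelowFive", crux]
def TwoAdicDihedral : Prop :=
  ∀ (ρ : Literature.NumberTheory.GaloisRepresentations.FramedGaloisRep ℚ (PadicAlgCl 2) 2), ρ.IsOdd → ρ.toGaloisRep.IsIrreducible → (∀ᶠ v : IsDedekindDomain.HeightOneSpectrum (NumberField.RingOfIntegers ℚ) in Filter.cofinite, ρ.IsUnramifiedAt v) → (∀ (v : IsDedekindDomain.HeightOneSpectrum (NumberField.RingOfIntegers ℚ)) (hv : ((2 : ℕ) : NumberField.RingOfIntegers ℚ) ∈ v.asIdeal), (Literature.NumberTheory.PAdicHodge.fontainePstAdicCompletion v 2 hv).IsDeRhamFramed (ρ.toLocal v) ∧ ∀ τ : v.adicCompletion ℚ →+* PadicAlgCl 2, Continuous τ → (ρ.labelledHodgeTateWeightsAt v (Literature.NumberTheory.PAdicHodge.fontainePstAdicCompletion v 2 hv).algebra (Literature.NumberTheory.PAdicHodge.fontainePstAdicCompletion v 2 hv).𝔅 τ).Nodup) → ρ.IsResiduallyAbsIrreducible → Literature.NumberTheory.GaloisRepresentations.IsDihedralType ρ.residualRep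 → ∀ (ι : PadicAlgCl 2 ≃+* ℂ) (hcpt : Literature.NumberTheory.Automorphic.isCompact_glFiniteIntegralLevel 2 ℚ), ∃ π : Literature.NumberTheory.Automorphic.CuspidalAutomorphicRepData 2 ℚ hcpt, π.1.IsLAlgebraic ∧ ∀ᶠ v : IsDedekindDomain.HeightOneSpectrum (NumberField.RingOfIntegers ℚ) in Filter.cofinite, Summit.Langlands.SatakeFrobCompatibleAt ι π.1 ρ v

/-- item stmt-Langlands-18717 · crux · rank 4 · open · by planner
why it might fail: Böckle's ring R(1 ⊕ ω, p = 3) is not formally smooth, so Pan's two dimension inequalities (a component of dim ≥ 1 + 2 through 𝔭 whose ordinary locus is cut by ONE equation) and the existence of nice primes may fail in the exceptional block; E_𝔅 is only finite over Z_𝔅, not computed.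
sources: arXiv:1901.07166, arXiv:2104.08948, zbl:1223.11141, arXiv:2209.06366, doi:10.5802/afst.988, arXiv:2105.05823
[crux] the target at p = 3 for ρ with ρ̄ absolutely reducible OR of dihedral type and ρ|G_ℚ₃
(absolutely) irreducible: re-run Pan 2022 (Thm 1.0.2 and §9) in the exceptional block 𝔅 = {1, Sp,
ω∘det, Sp⊗ω}⊗δ (Pan's excluded case (5): (ρ̄|G_ℚ₃)^ss = η ⊕ ηω) with Paškūnas–Tung 2021 Thms
1.3/1.4/Cor 1.5 in place of [Pas13] Thms 1.2/1.5, Böckle's explicit ring in place of Cor 9.13/B.20,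
and Pan II Thm 1.1.2 for classicality; the off-block and ordinary sub-cells are in print (DEFICIT.md
§2). [difficulty: L] -/
@[route_item "route-Langlands-OddResidueBelowFive", crux]
def ThreeAdicSmallImage : Prop :=
  ∀ (ρ : Literature.NumberTheory.GaloisRepresentations.FramedGaloisRep ℚ (PadicAlgCl 3) 2), ρ.IsOdd → ρ.toGaloisRep.IsIrreducible → (∀ᶠ v : IsDedekindDomain.HeightOneSpectrum (NumberField.RingOfIntegers ℚ) in Filter.cofinite, ρ.IsUnramifiedAt v) → (∀ (v : IsDedekindDomain.HeightOneSpectrum (NumberField.RingOfIntegers ℚ)) (hv : ((3 : ℕ) : NumberField.RingOfIntegers ℚ) ∈ v.asIdeal), (Literature.NumberTheory.PAdicHodge.fontainePstAdicCompletion v 3 hv).IsDeRhamFramed (ρ.toLocal v) ∧ ∀ τ : v.adicCompletion ℚ →+* PadicAlgCl 3, Continuous τ → (ρ.labelledHodgeTateWeightsAt v (Literature.NumberTheory.PAdicHodge.fontainePstAdicCompletion v 3 hv).algebra (Literature.NumberTheory.PAdicHodge.fontainePstAdicCompletion v 3 hv).𝔅 τ).Nodup) → (¬ ρ.IsResiduallyAbsIrreducible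 ∨ Literature.NumberTheory.GaloisRepresentations.IsDihedralType ρ.residualRep) → (∀ (v : IsDedekindDomain.HeightOneSpectrum (NumberField.RingOfIntegers ℚ)) (hv : ((3 : ℕ) : NumberField.RingOfIntegers ℚ) ∈ v.asIdeal), Literature.NumberTheory.GaloisRepresentations.FramedRep.IsIrreducible (ρ.toLocal v)) → ∀ (ι : PadicAlgCl 3 ≃+* ℂ) (hcpt : Literature.NumberTheory.Automorphic.isCompact_glFiniteIntegralLevel 2 ℚ), ∃ π : Literature.NumberTheory.Automorphic.CuspidalAutomorphicRepData 2 ℚ hcpt, π.1.IsLAlgebraic ∧ ∀ᶠ v : IsDedekindDomain.HeightOneSpectrum (NumberField.RingOfIntegers ℚ) in Filter.cofinite, Summit.Langlands.SatakeFrobCompatibleAt ι π.1 ρ v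

/-- item stmt-Langlands-18718 · support · rank 9 · open · by planner
sources: arXiv:1901.07166, arXiv:1803.07451, doi:10.1007/bf02698855, doi:10.5802/afst.988, doi:10.1007/s00222-009-0205-7
[support] the printed cells at ODD primes, as named facts to vendor (first-prover duty): (i) p ≥ 5,
all ρ̄ (Pan 2022 Thm 1.0.4 = Kisin + Hu–Tan + Paškūnas + Skinner–Wiles + Pan); (ii) p = 3, ρ̄
absolutely irreducible and not dihedral (then ρ̄|G_ℚ(ζ₃) is absolutely irreducible: Tung ANT 2021
Thm 1, residual modularity by Khare–Wintenberger); (iii) p = 3, ρ̄ reducible or dihedral with ρ|G_ℚ₃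
reducible (nearly ordinary: Skinner–Wiles 1999/2001, Pan 2022 §6 and Thm 1.0.4 — the
exceptional-block proviso does not touch these). [difficulty: provable-now] -/
@[route_item "route-Langlands-OddResidueBelowFive", crux]
def KnownOddPrimeCells : Prop :=
  (∀ (p : ℕ) [Fact p.Prime], 5 ≤ p → ∀ (ρ : Literature.NumberTheory.GaloisRepresentations.FramedGaloisRep ℚ (PadicAlgCl p) 2), ρ.IsOdd → ρ.toGaloisRep.IsIrreducible → (∀ᶠ v : IsDedekindDomain.HeightOneSpectrum (NumberField.RingOfIntegers ℚ) in Filter.cofinite, ρ.IsUnramifiedAt v) → (∀ (v : IsDedekindDomain.HeightOneSpectrum (NumberField.RingOfIntegers ℚ)) (hv : ((p : ℕ) : NumberField.RingOfIntegers ℚ) ∈ v.asIdeal), (Literature.NumberTheory.PAdicHodge.fontainePstAdicCompletion v p hv).IsDeRhamFramed (ρ.toLocal v) ∧ ∀ τ : v.adicCompletion ℚ →+* PadicAlgCl p, Continuous τ → (ρ.labelledHodgeTateWeightsAt v (Literature.NumberTheory.PAdicHodge.fontainePstAdicCompletion v p hv).algebra (Literature.NumberTheory.PAdicHodge.fontainePstAdicCompletion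 v p hv).𝔅 τ).Nodup) → ∀ (ι : PadicAlgCl p ≃+* ℂ) (hcpt : Literature.NumberTheory.Automorphic.isCompact_glFiniteIntegralLevel 2 ℚ), ∃ π : Literature.NumberTheory.Automorphic.CuspidalAutomorphicRepData 2 ℚ hcpt, π.1.IsLAlgebraic ∧ ∀ᶠ v : IsDedekindDomain.HeightOneSpectrum (NumberField.RingOfIntegers ℚ) in Filter.cofinite, Summit.Langlands.SatakeFrobCompatibleAt ι π.1 ρ v) ∧ (∀ (ρ : Literature.NumberTheory.GaloisRepresentations.FramedGaloisRep ℚ (PadicAlgCl 3) 2), ρ.IsOdd → ρ.toGaloisRep.IsIrreducible → (∀ᶠ v : IsDedekindDomain.HeightOneSpectrum (NumberField.RingOfIntegers ℚ) in Filter.cofinite, ρ.IsUnramifiedAt v) → (∀ (v : IsDedekindDomain.HeightOneSpectrum (NumberField.RingOfIntegers ℚ)) (hv : ((3 : ℕ) : NumberField.RingOfIntegers ℚ) ∈ v.asIdeal), (Literature.NumberTheory.PAdicHodge.fontainePstAdicCompletion v 3 hv).IsDeRhamFramed (ρ.toLocal v) ∧ ∀ τ : v.adicCompletion ℚ →+*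 PadicAlgCl 3, Continuous τ → (ρ.labelledHodgeTateWeightsAt v (Literature.NumberTheory.PAdicHodge.fontainePstAdicCompletion v 3 hv).algebra (Literature.NumberTheory.PAdicHodge.fontainePstAdicCompletion v 3 hv).𝔅 τ).Nodup) → ρ.IsResiduallyAbsIrreducible → ¬ Literature.NumberTheory.GaloisRepresentations.IsDihedralType ρ.residualRep → ∀ (ι : PadicAlgCl 3 ≃+* ℂ) (hcpt : Literature.NumberTheory.Automorphic.isCompact_glFiniteIntegralLevel 2 ℚ), ∃ π : Literature.NumberTheory.Automorphic.CuspidalAutomorphicRepData 2 ℚ hcpt, π.1.IsLAlgebraic ∧ ∀ᶠ v : IsDedekindDomain.HeightOneSpectrum (NumberField.RingOfIntegers ℚ) in Filter.cofinite, Summit.Langlands.SatakeFrobCompatibleAt ι π.1 ρ v) ∧ (∀ (ρ : Literature.NumberTheory.GaloisRepresentations.FramedGaloisRep ℚ (PadicAlgCl 3) 2), ρ.IsOdd → ρ.toGaloisRep.IsIrreducible → (∀ᶠ v : IsDedekindDomain.HeightOneSpectrum (NumberField.RingOfIntegers ℚ) in Filter.cofinite, ρ.IsUnramifiedAt v) →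 (∀ (v : IsDedekindDomain.HeightOneSpectrum (NumberField.RingOfIntegers ℚ)) (hv : ((3 : ℕ) : NumberField.RingOfIntegers ℚ) ∈ v.asIdeal), (Literature.NumberTheory.PAdicHodge.fontainePstAdicCompletion v 3 hv).IsDeRhamFramed (ρ.toLocal v) ∧ ∀ τ : v.adicCompletion ℚ →+* PadicAlgCl 3, Continuous τ → (ρ.labelledHodgeTateWeightsAt v (Literature.NumberTheory.PAdicHodge.fontainePstAdicCompletion v 3 hv).algebra (Literature.NumberTheory.PAdicHodge.fontainePstAdicCompletion v 3 hv).𝔅 τ).Nodup) → (¬ ρ.IsResiduallyAbsIrreducible ∨ Literature.NumberTheory.GaloisRepresentations.IsDihedralType ρ.residualRep) → ¬ (∀ (v : IsDedekindDomain.HeightOneSpectrum (NumberField.RingOfIntegers ℚ)) (hv : ((3 : ℕ) : NumberField.RingOfIntegers ℚ) ∈ v.asIdeal), Literature.NumberTheory.GaloisRepresentations.FramedRep.IsIrreducible (ρ.toLocal v)) → ∀ (ι : PadicAlgCl 3 ≃+* ℂ) (hcpt : Literature.NumberTheory.Automorphic.isCompact_glFiniteIntegralLevel 2 ℚ), ∃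 π : Literature.NumberTheory.Automorphic.CuspidalAutomorphicRepData 2 ℚ hcpt, π.1.IsLAlgebraic ∧ ∀ᶠ v : IsDedekindDomain.HeightOneSpectrum (NumberField.RingOfIntegers ℚ) in Filter.cofinite, Summit.Langlands.SatakeFrobCompatibleAt ι π.1 ρ v)

/-- item stmt-Langlands-18719 · support · rank 9 · open · by planner
sources: arXiv:1908.06174, doi:10.1007/s00222-009-0205-7, arXiv:1301.1113
[support] the printed cell at p = 2: ρ̄ absolutely irreducible and not dihedral (= non-solvable
image, by Dickson's classification in characteristic 2: A₄ lands in a Borel, S₄ does not embed) ⇒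
modular (Tung Math. Z. 2021 Thm 1; residual modularity by Khare–Wintenberger). [difficulty:
provable-now] -/
@[route_item "route-Langlands-OddResidueBelowFive", crux]
def KnownTwoAdicBigImage : Prop :=
  ∀ (ρ : Literature.NumberTheory.GaloisRepresentations.FramedGaloisRep ℚ (PadicAlgCl 2) 2), ρ.IsOdd → ρ.toGaloisRep.IsIrreducible → (∀ᶠ v : IsDedekindDomain.HeightOneSpectrum (NumberField.RingOfIntegers ℚ) in Filter.cofinite, ρ.IsUnramifiedAt v) → (∀ (v : IsDedekindDomain.HeightOneSpectrum (NumberField.RingOfIntegers ℚ)) (hv : ((2 : ℕ) : NumberField.RingOfIntegers ℚ) ∈ v.asIdeal), (Literature.NumberTheory.PAdicHodge.fontainePstAdicCompletion v 2 hv).IsDeRhamFramed (ρ.toLocal v) ∧ ∀ τ : v.adicCompletion ℚ →+* PadicAlgCl 2, Continuous τ → (ρ.labelledHodgeTateWeightsAt v (Literature.NumberTheory.PAdicHodge.fontainePstAdicCompletion v 2 hv).algebra (Literature.NumberTheory.PAdicHodge.fontainePstAdicCompletion v 2 hv).𝔅 τ).Nodup) → ρ.IsResiduallyAbsIrreducible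 → ¬ Literature.NumberTheory.GaloisRepresentations.IsDihedralType ρ.residualRep → ∀ (ι : PadicAlgCl 2 ≃+* ℂ) (hcpt : Literature.NumberTheory.Automorphic.isCompact_glFiniteIntegralLevel 2 ℚ), ∃ π : Literature.NumberTheory.Automorphic.CuspidalAutomorphicRepData 2 ℚ hcpt, π.1.IsLAlgebraic ∧ ∀ᶠ v : IsDedekindDomain.HeightOneSpectrum (NumberField.RingOfIntegers ℚ) in Filter.cofinite, Summit.Langlands.SatakeFrobCompatibleAt ι π.1 ρ v

/-- item stmt-Langlands-18720 · support · rank 9 · open · by planner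
sources: BuzzardGeeLMS2014, FontaineMazurGeometric1995
[support] the honest rest of the summit along this line — Langlands given the odd regular
Fontaine–Mazur theorem over ℚ at every prime (local–global compatibility at ALL places for classical
forms via Carayol/Saito and strong multiplicity one; clause (A); even ρ; equal weights; n ≠ 2; other
fields); NOT attacked by this route, shared in kind with every sector route of the summit.
[difficulty: open-problem] -/
@[route_item "route-Langlands-OddResidueBelowFive", crux]
def OddSectorToLanglands : Prop :=
  OddRegularModular → Langlands

/-- item stmt-Langlands-18721 · assembly · rank 1 · open · by planner
sources: arXiv:1901.07166, BuzzardGeeLMS2014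
[assembly] TwoAdicEisenstein → TwoAdicDihedral → ThreeAdicSmallImage → KnownOddPrimeCells →
KnownTwoAdicBigImage → OddSectorToLanglands → Langlands. -/
@[route_item "route-Langlands-OddResidueBelowFive"]
def Assembly : Prop :=
  TwoAdicEisenstein → TwoAdicDihedral → ThreeAdicSmallImage → KnownOddPrimeCells → KnownTwoAdicBigImage → OddSectorToLanglands → Langlands

/-! D-0027 §2.1 — DECIDING THEOREM (planner-authored via `route open/edit --closes-file`; by planner-plan-lens3-Langlands-nearmiss-g2-0 2026-08-17T02:57:00Z):
its hypotheses are this route's items and its conclusion the sub-problem Statement (glue_lint), and it elaborates with this file. -/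

@[closes "route-Langlands-OddResidueBelowFive"] theorem closes (hA : TwoAdicEisenstein) (hB : TwoAdicDihedral) (hC : ThreeAdicSmallImage)
    (hK : KnownOddPrimeCells) (hK2 : KnownTwoAdicBigImage) (hS : OddSectorToLanglands) :
    Langlands := by
  refine hS ?_
  intro p _ ρ hodd hirr hur hdR
  obtain ⟨hK5, hK3, hK3o⟩ := hK
  have hp : p.Prime := Fact.out
  by_cases h2 : p = 2
  · subst h2
    by_cases hri : ρ.IsResiduallyAbsIrreducible
    · by_cases hdih : Literature.NumberTheory.GaloisRepresentations.IsDihedralType ρ.residualRep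
      · exact hB ρ hodd hirr hur hdR hri hdih
      · exact hK2 ρ hodd hirr hur hdR hri hdih
    · exact hA ρ hodd hirr hur hdR hri
  by_cases h3 : p = 3
  · subst h3
    by_cases hsm : (¬ ρ.IsResiduallyAbsIrreducible ∨
        Literature.NumberTheory.GaloisRepresentations.IsDihedralType ρ.residualRep)
    · by_cases hss : ∀ (v : IsDedekindDomain.HeightOneSpectrum (NumberField.RingOfIntegers ℚ))
          (hv : ((3 : ℕ) : NumberField.RingOfIntegers ℚ) ∈ v.asIdeal),
          Literature.NumberTheory.GaloisRepresentations.FramedRep.IsIrreducible (ρ.toLocal v)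
      · exact hC ρ hodd hirr hur hdR hsm hss
      · exact hK3o ρ hodd hirr hur hdR hsm hss
    · simp only [not_or, not_not] at hsm
      exact hK3 ρ hodd hirr hur hdR hsm.1 hsm.2
  have h5 : 5 ≤ p := by
    have h2le := hp.two_le
    have h4 : p ≠ 4 := by rintro rfl; exact absurd hp (by decide)
    omega
  exact hK5 p h5 ρ hodd hirr hur hdR

end Summit.Langlands.Langlands.Theses.OddResidueBelowFive
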